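import Literature.MathematicalPhysics.QuantumFieldTheory.Balaban1983to89.B9B8KnitVsTaxicab
import Literature.MathematicalPhysics.QuantumFieldTheory.Balaban1983to89.B9Eq3132TentFlat

/-!
# `Balaban1983to89.B9B8KnitLetterCoercive` — [B9] THM 3.1's POSITIVITY STEP AT THE KNIT LETTER: on the class (3.35) ∩ (52),
# `(1∕32)·L^{−2k}·⟨Φ, Φ⟩ ≤ Re⟨Φ, Δ′_a(U; parKnitY)Φ⟩` uniformly (junction J-B file 6 — the coercivity TRANSFER from def-Y's letter of record)

statement-level skeleton of published theorems with citation tags; proofs where landed; nothing here is a claim about the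
Yang–Mills mass gap

T. Bałaban, *Propagators for lattice gauge theories in a background field*, Commun. Math. Phys. **99** (1985) 389–434 [`Balaban1985BackgroundPropagators`,
"[B9]"]; T. Bałaban, *Propagators and renormalization transformations for lattice gauge theories. II*, Commun. Math. Phys. **96** (1984) 223–250
[`Balaban1984PropagatorsII`]; T. Bałaban, *Averaging operations for lattice gauge theories*, Commun. Math. Phys. **98** (1985) 17–51 [`Balaban1985Averaging`].

THE PRINT.  [B9] Thm 3.1 p. 397 / Thm 3.11 p. 416: *«G′(U) = Δ′(U)⁻¹ … positive operator … assuming some regularity of U»*, the form (3.24) p. 394 with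
the averaging operators (3.19) p. 393 whose transporters are *«defined by (52), (53) in [5]»* — i.e. AT THE KNIT LETTER.  dag-w1's `B9Thm31SiteCoerciveReg335Y`
proved the uniform lower bound `(1∕8)·L^{−2k}` at def-Y's taxicab letter of record `parSymY` on the class (3.35); this file TRANSFERS it to the knit letter
`parKnitY` of the junction, at the cost of the transporter dictionary of file 5b (`‖parKnitY − parSymY‖ ≤ 8(d+1)²α₀′` at corner pairs on [B7]'s class (52)):
the block sums of (3.24) at the two letters differ by `O(α₀′)` in Hilbert–Schmidt norm, block by block.

CITATION HEADER (lean-in-tree rule).  Cell `lit-balaban`, sub-row G-B9-LETTERS, junction J-B (lead RULINGS #3–#4) file 6 → seat `lit-balaban-p33` gen 91.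
REUSED BY NAME: dag-w1's ★ `trIP_deltaPrimeAY_parSymY_ge_levelMass` (the bound at the letter of record, used as a black box), dag-n06-j's `trIP_deltaPrimeAY_eq`
((3.24) as gradient + block sums), `blkSumY`, the HS bookkeeping (`hs_add_le`, `hs_mul_left_le`, `hs_mul_right_le`, `hs_sum_le_card_mul`, `hs_nonneg`,
`hs_eq_re_trace`), junction files 4b/5b (`parKnitY_mem_of_pdev`, `parKnitY_inv`, `norm_parKnitY_sub_parSymY_le`).

WHAT THIS FILE PROVES (sorry-free; no new definitions).
* §1 `hs_R_sub_R_le`: `HS(R(V)X − R(V′)X) ≤ 4‖V − V′‖²·HS(X)` for contraction pairs; `norm_le_one_of_mem_unitary`.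
* §2 ★ `hs_blkSumY_parSymY_le_knit`: per block `s` (side `n`), `HS(blkSum_{parSymY}) ≤ 2·HS(blkSum_{parKnitY}) + 8n^{d+1}δ²·Σ_{z∈s}HS(Φ z)` whenever
  `‖parKnitY U c_s z − parSymY U c_s z‖ ≤ δ` on `s`.
* §3 ★★★ `trIP_deltaPrimeAY_parKnitY_ge_levelMass`: for `G ≤ U(N)` averaging-closed, `N ≥ 1`, `U ∈ Reg335 c α₀` with dag-w1's smallness
  (`0 ≤ cMα₀`, `cMα₀(d+1) ≤ 1∕16`) AND `pdev (liftCfg U) < α₀′(L^k)⁻²` with Prop. 2's smallness and `(d+1)²α₀′ ≤ 1∕100`: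
  `(1∕32)·Σ_z (L^{j(z)})⁻²·HS(Φ z) ≤ Re⟨Φ, Δ′_a(U; parKnitY)Φ⟩_tr`; ★★★ `trIP_deltaPrimeAY_parKnitY_ge`: `(1∕32)(L^k)⁻²⟨Φ,Φ⟩ ≤ Re⟨Φ, Δ′_a(U; parKnitY)Φ⟩`.

HONEST SCOPE.  The constant drops from `1∕8` to `1∕32` (a factor `2` for the block-sum comparison, a factor `2` absorbed by the `δ²` term); the (52)
hypothesis on the lift is carried explicitly (the typed (3.35) does not assert it on uncovered plaquettes — junction file 4b's header).  Nothing of Thm 3.1's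
decay (3.42) is proved here; count-neutral; nothing continuum, nothing about OS axioms or the mass gap.  No `sorry`, no `axiom`, no `instance`, no `notation`.
Seat `lit-balaban-p33` gen 91, 2026-08-28.
-/

noncomputable section

namespace Literature.MathematicalPhysics.QuantumFieldTheory.Balaban1983to89.B9B8KnitLetterCoercive

open B9Thm311ReadingCoords B9Thm311DeltaPrimePos B9Ineq369CurvatureSmallAtLettersY Node00
open B6KLevelCensusIndexV1 B6Geom246MultiLevelBox B6MultiLevelBoxOperator B9Eq39Adjoint B9BackgroundsKLevelV1 B6GlobalChartV1
open B4Lower18 (RBond rsrc rtgt rblk)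
open B7Prop1Explicit (U1 mem_U1)
open B7Prop2Explicit (AvgClosed pdev C0 c2')
open B9B8CarrierDictionary (liftCfg)
open B9B8AveragingJunction (parKnitY parKnitY_inv)
open B9B8KnitLetterRegular (parKnitY_mem_of_pdev)
open B9B8KnitVsTaxicab (norm_parKnitY_sub_parSymY_le)
open B9Thm31SiteCoerciveGaugeBlockY (two_le_side isBlockUnion_XB filter_rblk_eq_filter_blkOf)
open B9Thm31SiteCoerciveReg335Y (trIP_deltaPrimeAY_parSymY_ge_levelMass levC_mul_side_pow)
open scoped Matrix Matrix.Norms.L2Operator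

variable {d ℓ : ℕ} {hd : 1 ≤ d + 1} {hL : Odd (ℓ + 1) ∧ 1 < ℓ + 1} {b₀ b₁ : ℝ}

/-! ## §1 Hilbert–Schmidt bookkeeping: two conjugations -/

section HS

variable {N : ℕ}

/-- a unitary-valued unit is a contraction pair (`|g| ≤ 1`, `|g⁻¹| ≤ 1`). [cite: Balaban1985Averaging, (19) p.21, bookkeeping] -/
theorem contraction_of_mem_unitary [Nonempty (Fin N)] {G : Subgroup (Matrix (Fin N) (Fin N) ℂ)ˣ} (hG : G ≤ B7Prop2Explicit.unitaryUnits (Matrix (Fin N) (Fin N) ℂ))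
    {g : (Matrix (Fin N) (Fin N) ℂ)ˣ} (hg : g ∈ G) :
    ‖(g : Matrix (Fin N) (Fin N) ℂ)‖ ≤ 1 ∧ ‖((g⁻¹ : (Matrix (Fin N) (Fin N) ℂ)ˣ) : Matrix (Fin N) (Fin N) ℂ)‖ ≤ 1 :=
  ⟨(CStarRing.norm_of_mem_unitary (B7Prop2Explicit.mem_unitaryUnits.1 (hG hg))).le,
    (CStarRing.norm_of_mem_unitary (B7Prop2Explicit.mem_unitaryUnits.1 (hG (G.inv_mem hg)))).le⟩

/-- ★ TWO CONJUGATIONS: for contraction pairs `V, V′` with `‖V − V′‖ ≤ δ`, `HS(R(V)X − R(V′)X) ≤ 4δ²·HS(X)`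
(`R(V)X − R(V′)X = (V − V′)XV⁻¹ + V′X(V⁻¹ − V′⁻¹)`, `‖V⁻¹ − V′⁻¹‖ ≤ ‖V − V′‖`). [cite: Balaban1985Averaging, (17)–(20) pp.20–21, bookkeeping] -/
theorem hs_R_sub_R_le [Nonempty (Fin N)] {V V' : (Matrix (Fin N) (Fin N) ℂ)ˣ}
    (hV : ‖(V : Matrix (Fin N) (Fin N) ℂ)‖ ≤ 1 ∧ ‖((V⁻¹ : (Matrix (Fin N) (Fin N) ℂ)ˣ) : Matrix (Fin N) (Fin N) ℂ)‖ ≤ 1)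
    (hV' : ‖(V' : Matrix (Fin N) (Fin N) ℂ)‖ ≤ 1 ∧ ‖((V'⁻¹ : (Matrix (Fin N) (Fin N) ℂ)ˣ) : Matrix (Fin N) (Fin N) ℂ)‖ ≤ 1)
    {δ : ℝ} (hδ : ‖(V : Matrix (Fin N) (Fin N) ℂ) - V'‖ ≤ δ) (X : Matrix (Fin N) (Fin N) ℂ) :
    ∑ a, ∑ b, ‖(R V X - R V' X) a b‖ ^ 2 ≤ 4 * δ ^ 2 * ∑ a, ∑ b, ‖X a b‖ ^ 2 := by
  have hδ0 : 0 ≤ δ := le_trans (norm_nonneg _) hδ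
  set Vm : Matrix (Fin N) (Fin N) ℂ := (V : Matrix (Fin N) (Fin N) ℂ)
  set Vi : Matrix (Fin N) (Fin N) ℂ := ((V⁻¹ : (Matrix (Fin N) (Fin N) ℂ)ˣ) : Matrix (Fin N) (Fin N) ℂ)
  set Wm : Matrix (Fin N) (Fin N) ℂ := (V' : Matrix (Fin N) (Fin N) ℂ)
  set Wi : Matrix (Fin N) (Fin N) ℂ := ((V'⁻¹ : (Matrix (Fin N) (Fin N) ℂ)ˣ) : Matrix (Fin N) (Fin N) ℂ)
  have hsplit : R V X - R V' X = (Vm - Wm) * X * Vi + Wm * X * (Vi - Wi) := by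
    rw [R_def, R_def]; noncomm_ring
  have hinv : ‖Vi - Wi‖ ≤ δ :=
    (B9B8AveragedBondsStraight.norm_inv_sub_inv_le (u := V) (v := V') (mem_U1.2 hV) (mem_U1.2 hV')).trans hδ
  have h1 : ∑ a, ∑ b, ‖((Vm - Wm) * X * Vi) a b‖ ^ 2 ≤ δ ^ 2 * ∑ a, ∑ b, ‖X a b‖ ^ 2 := by
    refine (hs_mul_right_le _ _).trans ?_
    refine (mul_le_mul_of_nonneg_left (hs_mul_left_le _ _) (sq_nonneg _)).trans ?_
    have hn1 : ‖Vi‖ ^ 2 ≤ 1 := by nlinarith [hV.2, norm_nonneg Vi]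
    have hn2 : ‖Vm - Wm‖ ^ 2 ≤ δ ^ 2 := pow_le_pow_left₀ (norm_nonneg _) hδ 2
    have hX := hs_nonneg X
    calc ‖Vi‖ ^ 2 * (‖Vm - Wm‖ ^ 2 * ∑ a, ∑ b, ‖X a b‖ ^ 2) ≤ 1 * (δ ^ 2 * ∑ a, ∑ b, ‖X a b‖ ^ 2) :=
          mul_le_mul hn1 (mul_le_mul_of_nonneg_right hn2 hX) (by positivity) zero_le_one
      _ = _ := one_mul _
  have h2 : ∑ a, ∑ b, ‖(Wm * X * (Vi - Wi)) a b‖ ^ 2 ≤ δ ^ 2 * ∑ a, ∑ b, ‖X a b‖ ^ 2 := by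
    refine (hs_mul_right_le _ _).trans ?_
    refine (mul_le_mul_of_nonneg_left (hs_mul_left_le _ _) (sq_nonneg _)).trans ?_
    have hn1 : ‖Wm‖ ^ 2 ≤ 1 := by nlinarith [hV'.1, norm_nonneg Wm]
    have hn2 : ‖Vi - Wi‖ ^ 2 ≤ δ ^ 2 := pow_le_pow_left₀ (norm_nonneg _) hinv 2
    have hX := hs_nonneg X
    calc ‖Vi - Wi‖ ^ 2 * (‖Wm‖ ^ 2 * ∑ a, ∑ b, ‖X a b‖ ^ 2) ≤ δ ^ 2 * (1 * ∑ a, ∑ b, ‖X a b‖ ^ 2) :=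
          mul_le_mul hn2 (mul_le_mul_of_nonneg_right hn1 hX) (by positivity) (sq_nonneg _)
      _ = _ := by rw [one_mul]
  rw [hsplit]
  exact (hs_add_le _ _).trans (by linarith)

end HS

/-! ## §2 The block sums of (3.24) at the two letters -/

section BlockSums

variable (i : KIdx d ℓ hd hL b₀ b₁) {N : ℕ}

/-- ★ **THE BLOCK SUMS AT THE TWO LETTERS**: if on the block `s` (side `n`) every pair of transporters is a pair of contraction pairs with
`‖parKnitY U c_s z − parSymY U c_s z‖ ≤ δ`, then `HS(Σ_{z∈s}R(parSymY)Φ z) ≤ 2·HS(Σ_{z∈s}R(parKnitY)Φ z) + 8·n^{d+1}·δ²·Σ_{z∈s}HS(Φ z)`.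
[cite: Balaban1985BackgroundPropagators, (3.19) p.393, (3.24) p.394, (3.40) p.397; Balaban1984PropagatorsII, (2.16)–(2.17) p.225] -/
theorem hs_blkSumY_parSymY_le_knit [Nonempty (Fin N)] (U : CfgY (Matrix (Fin N) (Fin N) ℂ) i) (Φ : SiteY i → Matrix (Fin N) (Fin N) ℂ) (s : BlkY i) {δ : ℝ}
    (hK : ∀ z : SiteY i, blkOf i.D.toDomains z = s →
      ‖(parKnitY i U (blkCornerY i s) z : Matrix (Fin N) (Fin N) ℂ)‖ ≤ 1 ∧ ‖(((parKnitY i U (blkCornerY i s) z)⁻¹ : (Matrix (Fin N) (Fin N) ℂ)ˣ) : Matrix (Fin N) (Fin N) ℂ)‖ ≤ 1)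
    (hS : ∀ z : SiteY i, blkOf i.D.toDomains z = s →
      ‖(parSymY i U (blkCornerY i s) z : Matrix (Fin N) (Fin N) ℂ)‖ ≤ 1 ∧ ‖(((parSymY i U (blkCornerY i s) z)⁻¹ : (Matrix (Fin N) (Fin N) ℂ)ˣ) : Matrix (Fin N) (Fin N) ℂ)‖ ≤ 1)
    (hδ : ∀ z : SiteY i, blkOf i.D.toDomains z = s →
      ‖(parSymY i U (blkCornerY i s) z : Matrix (Fin N) (Fin N) ℂ) - parKnitY i U (blkCornerY i s) z‖ ≤ δ) :
    ∑ a, ∑ b, ‖blkSumY i (parSymY i) U Φ s a b‖ ^ 2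
      ≤ 2 * ∑ a, ∑ b, ‖blkSumY i (parKnitY i) U Φ s a b‖ ^ 2
        + 8 * (((ℓ + 1) ^ s.1.1 : ℕ) : ℝ) ^ (d + 1) * δ ^ 2 *
            ∑ z ∈ Finset.univ.filter (fun z : SiteY i => blkOf i.D.toDomains z = s), ∑ a, ∑ b, ‖Φ z a b‖ ^ 2 := by
  set B := Finset.univ.filter (fun z : SiteY i => blkOf i.D.toDomains z = s) with hB
  have hmem : ∀ {z}, z ∈ B → blkOf i.D.toDomains z = s := fun {z} hz => by simpa [hB] using hz
  have hsplit : blkSumY i (parSymY i) U Φ s = blkSumY i (parKnitY i) U Φ s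
      + ∑ z ∈ B, (R (parSymY i U (blkCornerY i s) z) (Φ z) - R (parKnitY i U (blkCornerY i s) z) (Φ z)) := by
    rw [blkSumY, blkSumY, ← Finset.sum_add_distrib]
    exact Finset.sum_congr rfl fun z _ => by abel
  rw [hsplit]
  refine (hs_add_le _ _).trans (add_le_add le_rfl ?_)
  have h2 := B9Eq3132TentFlat.hs_sum_le_card_mul B (fun z => R (parSymY i U (blkCornerY i s) z) (Φ z) - R (parKnitY i U (blkCornerY i s) z) (Φ z))
  have h3 : ∑ z ∈ B, ∑ a, ∑ b, ‖(R (parSymY i U (blkCornerY i s) z) (Φ z) - R (parKnitY i U (blkCornerY i s) z) (Φ z)) a b‖ ^ 2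
      ≤ ∑ z ∈ B, 4 * δ ^ 2 * ∑ a, ∑ b, ‖Φ z a b‖ ^ 2 :=
    Finset.sum_le_sum fun z hz => hs_R_sub_R_le (hS z (hmem hz)) (hK z (hmem hz)) (hδ z (hmem hz)) (Φ z)
  rw [← Finset.mul_sum] at h3
  have hcard : (B.card : ℝ) = (((ℓ + 1) ^ s.1.1 : ℕ) : ℝ) ^ (d + 1) := by
    rw [hB, ← filter_rblk_eq_filter_blkOf i s,
      B4Lower18.card_filter_rblk (le_trans one_le_two (two_le_side i s)) (isBlockUnion_XB i (scale_bounds i.D.toDomains s).2)]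
    push_cast; ring
  have hcard0 : 0 ≤ (B.card : ℝ) := Nat.cast_nonneg _
  have h4 := mul_le_mul_of_nonneg_left h3 hcard0
  rw [hcard] at h2 h4
  linarith

end BlockSums

/-! ## §3 The coercivity transfer -/

section Main

variable (i : KIdx d ℓ hd hL b₀ b₁) {N : ℕ} {G : Subgroup (Matrix (Fin N) (Fin N) ℂ)ˣ}
set_option maxHeartbeats 400000 in
/-- ★★★ **[B9] THM 3.1's POSITIVITY STEP AT THE KNIT LETTER, UNIFORM ON THE CLASS (3.35) ∩ (52)**: for `G ≤ U(N)` averaging-closed, `N ≥ 1`,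
`U ∈ (bg9K (M_N ℂ) G i).Reg335 c α₀` with `0 ≤ cMα₀`, `cMα₀(d+1) ≤ 1∕16`, and the lift on [B7]'s class (52) `pdev (liftCfg U) < α₀′(L^k)⁻²` with `0 < α₀′`,
`C₀α₀′ ≤ ⅓`, `2α₀′ ≤ c₂′`, `(d+1)²α₀′ ≤ 1∕100`:  `(1∕32)·Σ_z (L^{j(z)})⁻²·HS(Φ z) ≤ Re⟨Φ, Δ′_a(U; parKnitY)Φ⟩_tr` for every `Φ`.
[cite: Balaban1985BackgroundPropagators, Thm 3.1 p.397, Thm 3.11 p.416, (3.19) p.393, (3.24) p.394, (3.35) p.396; Balaban1984PropagatorsII, (2.14) p.225; Balaban1985Averaging, (52)–(53) pp.26–27] -/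
theorem trIP_deltaPrimeAY_parKnitY_ge_levelMass [Nonempty (Fin N)] (hG : G ≤ B7Prop2Explicit.unitaryUnits (Matrix (Fin N) (Fin N) ℂ))
    (hGa : AvgClosed (d + 1) (ℓ + 1) G) {U : CfgY (Matrix (Fin N) (Fin N) ℂ) i} {c α₀ : ℝ} (hC0 : 0 ≤ c * (kGeo i).M * α₀)
    (hC1 : c * (kGeo i).M * α₀ * ((d : ℝ) + 1) ≤ 1 / 16) (hreg : (bg9K (Matrix (Fin N) (Fin N) ℂ) G i).Reg335 c α₀ U)
    {α₀' : ℝ} (hα : 0 < α₀') (hα3 : C0 (d + 1) * α₀' ≤ 1 / 3) (hα2 : 2 * α₀' ≤ c2' (d + 1) (ℓ + 1)) (hαd : ((d : ℝ) + 1) ^ 2 * α₀' ≤ 1 / 100)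
    (h52 : pdev (liftCfg U) < α₀' * ((((ℓ + 1 : ℕ) : ℝ) ^ i.k)⁻¹) ^ 2) (Φ : SiteY i → Matrix (Fin N) (Fin N) ℂ) :
    (1 / 32 : ℝ) * ∑ z : SiteY i, (((((ℓ + 1) ^ (blkOf i.D.toDomains z).1.1 : ℕ) : ℝ)) ^ 2)⁻¹ * ∑ a, ∑ b, ‖Φ z a b‖ ^ 2
      ≤ trIP (fun _ => (1 : ℝ)) Φ (deltaPrimeAY i (parKnitY i) U Φ) := by
  have hU : ∀ μ x, U μ x ∈ G := hreg.1
  have hd1 : 1 ≤ d + 1 := Nat.succ_pos d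
  have hparK : ∀ z w : SiteY i, parKnitY i U z w ∈ G := fun z w => parKnitY_mem_of_pdev i hGa hU hα hα3 hα2 h52 z w
  -- the bound at the letter of record (dag-w1), and (3.24) at both letters
  have hsym := trIP_deltaPrimeAY_parSymY_ge_levelMass i hG hC0 hC1 hreg Φ
  rw [trIP_deltaPrimeAY_eq i hG (parSymY i) U (parSymY_inv_symm U) (fun z w => parSymY_mem i hU z w) hU Φ] at hsym
  rw [trIP_deltaPrimeAY_eq i hG (parKnitY i) U (fun z w => parKnitY_inv i U z w) hparK hU Φ]
  -- HS currency
  have hre : ∀ (par : SiteParY (Matrix (Fin N) (Fin N) ℂ) i) (s : BlkY i),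
      (Matrix.trace ((blkSumY i par U Φ s)ᴴ * blkSumY i par U Φ s)).re = ∑ a, ∑ b, ‖blkSumY i par U Φ s a b‖ ^ 2 := fun par s => (hs_eq_re_trace _).symm
  simp only [hre] at hsym ⊢
  -- the transporter dictionary, block by block
  set δ : ℝ := 8 * ((d : ℝ) + 1) ^ 2 * α₀' with hδdef
  have hδ0 : 0 ≤ δ := by positivity
  have hδ1 : 8 * δ ^ 2 ≤ 1 / 16 := by rw [hδdef]; nlinarith [hαd, sq_nonneg (((d : ℝ) + 1) ^ 2 * α₀'), show 0 ≤ ((d : ℝ) + 1) ^ 2 * α₀' by positivity]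
  have h52' : pdev (liftCfg U) < α₀' * ((((ℓ : ℝ) + 1) ^ i.k)⁻¹) ^ 2 := by push_cast at h52; exact h52
  have hper : ∀ s : BlkY i,
      ∑ a, ∑ b, ‖blkSumY i (parSymY i) U Φ s a b‖ ^ 2
        ≤ 2 * ∑ a, ∑ b, ‖blkSumY i (parKnitY i) U Φ s a b‖ ^ 2
          + 8 * (((ℓ + 1) ^ s.1.1 : ℕ) : ℝ) ^ (d + 1) * δ ^ 2 *
              ∑ z ∈ Finset.univ.filter (fun z : SiteY i => blkOf i.D.toDomains z = s), ∑ a, ∑ b, ‖Φ z a b‖ ^ 2 := by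
    intro s
    refine hs_blkSumY_parSymY_le_knit i U Φ s (fun z _ => contraction_of_mem_unitary hG (hparK _ _))
      (fun z _ => contraction_of_mem_unitary hG (parSymY_mem i hU _ _)) (fun z hz => ?_)
    rw [norm_sub_rev]
    refine (norm_parKnitY_sub_parSymY_le i hd1 hGa hU hα hα3 hα2 h52' hz).trans ?_
    -- `(L^j∕L^k)² ≤ 1`
    have hjk : s.1.1 ≤ i.k := (scale_bounds i.D.toDomains s).2
    have hL1 : (1 : ℝ) ≤ (ℓ : ℝ) + 1 := by have : (0 : ℝ) ≤ ℓ := Nat.cast_nonneg ℓ; linarith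
    have hpk : 0 < ((ℓ : ℝ) + 1) ^ i.k := by positivity
    have hr : (((ℓ : ℝ) + 1) ^ s.1.1) ^ 2 * ((((ℓ : ℝ) + 1) ^ i.k)⁻¹) ^ 2 ≤ 1 := by
      have h1 : ((ℓ : ℝ) + 1) ^ s.1.1 * (((ℓ : ℝ) + 1) ^ i.k)⁻¹ ≤ 1 := by
        rw [mul_inv_le_iff₀ hpk, one_mul]; exact pow_le_pow_right₀ hL1 hjk
      have h0 : 0 ≤ ((ℓ : ℝ) + 1) ^ s.1.1 * (((ℓ : ℝ) + 1) ^ i.k)⁻¹ := by positivity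
      have : (((ℓ : ℝ) + 1) ^ s.1.1) ^ 2 * ((((ℓ : ℝ) + 1) ^ i.k)⁻¹) ^ 2 = (((ℓ : ℝ) + 1) ^ s.1.1 * (((ℓ : ℝ) + 1) ^ i.k)⁻¹) ^ 2 := by ring
      rw [this]; nlinarith
    rw [hδdef]
    have h0 : 0 ≤ 8 * ((d : ℝ) + 1) ^ 2 * α₀' := by positivity
    nlinarith
  -- weigh the blocks by `levC_s` and sum: `levC_s·n^{d+1} = a_s·n⁻² ≤ n⁻²`
  have hsumS : ∑ s : BlkY i, levC d ℓ (aPrinted ℓ 1) s.1.1 * ∑ a, ∑ b, ‖blkSumY i (parSymY i) U Φ s a b‖ ^ 2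
      ≤ 2 * ∑ s : BlkY i, levC d ℓ (aPrinted ℓ 1) s.1.1 * ∑ a, ∑ b, ‖blkSumY i (parKnitY i) U Φ s a b‖ ^ 2
        + 8 * δ ^ 2 * ∑ s : BlkY i, (((((ℓ + 1) ^ s.1.1 : ℕ) : ℝ)) ^ 2)⁻¹ *
            ∑ z ∈ Finset.univ.filter (fun z : SiteY i => blkOf i.D.toDomains z = s), ∑ a, ∑ b, ‖Φ z a b‖ ^ 2 := by
    rw [Finset.mul_sum, Finset.mul_sum, ← Finset.sum_add_distrib]
    refine Finset.sum_le_sum fun s _ => ?_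
    have hκ : 0 ≤ levC d ℓ (aPrinted ℓ 1) s.1.1 := (levC_blk_pos i s).le
    have h := mul_le_mul_of_nonneg_left (hper s) hκ
    have hκn := levC_mul_side_pow i s
    have ha1 : aPrinted ℓ 1 s.1.1 ≤ 1 := B6Prop23KLevelTorusCensus.aPrinted_le_one (by have := i.hℓ; omega) _ (one_le_level i s)
    have hM0 : 0 ≤ ∑ z ∈ Finset.univ.filter (fun z : SiteY i => blkOf i.D.toDomains z = s), ∑ a, ∑ b, ‖Φ z a b‖ ^ 2 :=
      Finset.sum_nonneg fun _ _ => hs_nonneg _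
    have hn0 : 0 ≤ (((((ℓ + 1) ^ s.1.1 : ℕ) : ℝ)) ^ 2)⁻¹ := inv_nonneg.2 (by positivity)
    have hw : levC d ℓ (aPrinted ℓ 1) s.1.1 * (8 * (((ℓ + 1) ^ s.1.1 : ℕ) : ℝ) ^ (d + 1) * δ ^ 2)
        ≤ 8 * δ ^ 2 * (((((ℓ + 1) ^ s.1.1 : ℕ) : ℝ)) ^ 2)⁻¹ := by
      have : levC d ℓ (aPrinted ℓ 1) s.1.1 * (8 * (((ℓ + 1) ^ s.1.1 : ℕ) : ℝ) ^ (d + 1) * δ ^ 2)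
          = 8 * δ ^ 2 * (aPrinted ℓ 1 s.1.1 * (((((ℓ + 1) ^ s.1.1 : ℕ) : ℝ)) ^ 2)⁻¹) := by rw [← hκn]; ring
      rw [this]
      have h8 : 0 ≤ 8 * δ ^ 2 := by positivity
      exact mul_le_mul_of_nonneg_left (by nlinarith) h8
    have hw' := mul_le_mul_of_nonneg_right hw hM0
    calc levC d ℓ (aPrinted ℓ 1) s.1.1 * ∑ a, ∑ b, ‖blkSumY i (parSymY i) U Φ s a b‖ ^ 2
        ≤ levC d ℓ (aPrinted ℓ 1) s.1.1 * (2 * ∑ a, ∑ b, ‖blkSumY i (parKnitY i) U Φ s a b‖ ^ 2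
            + 8 * (((ℓ + 1) ^ s.1.1 : ℕ) : ℝ) ^ (d + 1) * δ ^ 2 *
                ∑ z ∈ Finset.univ.filter (fun z : SiteY i => blkOf i.D.toDomains z = s), ∑ a, ∑ b, ‖Φ z a b‖ ^ 2) := h
      _ ≤ 2 * (levC d ℓ (aPrinted ℓ 1) s.1.1 * ∑ a, ∑ b, ‖blkSumY i (parKnitY i) U Φ s a b‖ ^ 2)
            + 8 * δ ^ 2 * ((((((ℓ + 1) ^ s.1.1 : ℕ) : ℝ)) ^ 2)⁻¹ *
                ∑ z ∈ Finset.univ.filter (fun z : SiteY i => blkOf i.D.toDomains z = s), ∑ a, ∑ b, ‖Φ z a b‖ ^ 2) := by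
            nlinarith [hw']
  -- regroup the mass by sites
  have hmass : ∑ s : BlkY i, (((((ℓ + 1) ^ s.1.1 : ℕ) : ℝ)) ^ 2)⁻¹ *
        ∑ z ∈ Finset.univ.filter (fun z : SiteY i => blkOf i.D.toDomains z = s), ∑ a, ∑ b, ‖Φ z a b‖ ^ 2
      = ∑ z : SiteY i, (((((ℓ + 1) ^ (blkOf i.D.toDomains z).1.1 : ℕ) : ℝ)) ^ 2)⁻¹ * ∑ a, ∑ b, ‖Φ z a b‖ ^ 2 := by
    rw [← Finset.sum_fiberwise Finset.univ (fun z : SiteY i => blkOf i.D.toDomains z)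
      (fun z => ((((((ℓ + 1) ^ (blkOf i.D.toDomains z).1.1 : ℕ) : ℝ)) ^ 2)⁻¹ * ∑ a, ∑ b, ‖Φ z a b‖ ^ 2))]
    refine Finset.sum_congr rfl fun s _ => ?_
    rw [Finset.mul_sum]
    refine Finset.sum_congr rfl fun z hz => ?_
    rw [(Finset.mem_filter.1 hz).2]
  rw [hmass] at hsumS
  -- assemble: `(1/8)·m ≤ G + S ≤ 2(G + K) + 8δ²·m`
  have hG0 : 0 ≤ ∑ μ : Fin (d + 1), trIP (fun _ => (1 : ℝ)) (cdS i U μ Φ) (cdS i U μ Φ) :=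
    Finset.sum_nonneg fun μ _ => by rw [trIP_one_self_eq]; exact Finset.sum_nonneg fun _ _ => hs_nonneg _
  have hK0 : 0 ≤ ∑ s : BlkY i, levC d ℓ (aPrinted ℓ 1) s.1.1 * ∑ a, ∑ b, ‖blkSumY i (parKnitY i) U Φ s a b‖ ^ 2 :=
    Finset.sum_nonneg fun s _ => mul_nonneg (levC_blk_pos i s).le (hs_nonneg _)
  have hm0 : 0 ≤ ∑ z : SiteY i, (((((ℓ + 1) ^ (blkOf i.D.toDomains z).1.1 : ℕ) : ℝ)) ^ 2)⁻¹ * ∑ a, ∑ b, ‖Φ z a b‖ ^ 2 :=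
    Finset.sum_nonneg fun z _ => mul_nonneg (inv_nonneg.2 (by positivity)) (hs_nonneg _)
  nlinarith [hsym, hsumS, hδ1, hG0, hK0, hm0]

/-- ★★★ **THE UNIFORM `L^{−2k}` LOWER BOUND AT THE KNIT LETTER**: on the class, `(1∕32)·(L^k)⁻²·⟨Φ, Φ⟩ ≤ Re⟨Φ, Δ′_a(U; parKnitY)Φ⟩` — so
`G′(U) = Δ′_a(U; parKnitY)⁻¹` (junction file 3's `isUnit_deltaPrimeAY_parKnitY`) has `L²`-operator norm `≤ 32·L^{2k}` UNIFORMLY over the class, the member and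
`N`; the operator whose inverse the [B8] consumer pins ((E1), junction files 2–4a) is uniformly coercive.
[cite: Balaban1985BackgroundPropagators, Thm 3.1 p.397, Thm 3.11 p.416, (3.19) p.393; Balaban1984PropagatorsII, p.225 («G′ = Δ′_a^{−1} is a well defined, positive operator»)] -/
theorem trIP_deltaPrimeAY_parKnitY_ge [Nonempty (Fin N)] (hG : G ≤ B7Prop2Explicit.unitaryUnits (Matrix (Fin N) (Fin N) ℂ))
    (hGa : AvgClosed (d + 1) (ℓ + 1) G) {U : CfgY (Matrix (Fin N) (Fin N) ℂ) i} {c α₀ : ℝ} (hC0 : 0 ≤ c * (kGeo i).M * α₀)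
    (hC1 : c * (kGeo i).M * α₀ * ((d : ℝ) + 1) ≤ 1 / 16) (hreg : (bg9K (Matrix (Fin N) (Fin N) ℂ) G i).Reg335 c α₀ U)
    {α₀' : ℝ} (hα : 0 < α₀') (hα3 : C0 (d + 1) * α₀' ≤ 1 / 3) (hα2 : 2 * α₀' ≤ c2' (d + 1) (ℓ + 1)) (hαd : ((d : ℝ) + 1) ^ 2 * α₀' ≤ 1 / 100)
    (h52 : pdev (liftCfg U) < α₀' * ((((ℓ + 1 : ℕ) : ℝ) ^ i.k)⁻¹) ^ 2) (Φ : SiteY i → Matrix (Fin N) (Fin N) ℂ) :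
    (1 / 32 : ℝ) * (((((ℓ + 1) ^ i.k : ℕ) : ℝ)) ^ 2)⁻¹ * trIP (fun _ => (1 : ℝ)) Φ Φ ≤ trIP (fun _ => (1 : ℝ)) Φ (deltaPrimeAY i (parKnitY i) U Φ) := by
  refine le_trans ?_ (trIP_deltaPrimeAY_parKnitY_ge_levelMass i hG hGa hC0 hC1 hreg hα hα3 hα2 hαd h52 Φ)
  rw [trIP_one_self_eq, Finset.mul_sum, Finset.mul_sum]
  refine Finset.sum_le_sum fun z _ => ?_
  have hz0 : 0 ≤ ∑ a, ∑ b, ‖Φ z a b‖ ^ 2 := hs_nonneg _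
  have hjk : (blkOf i.D.toDomains z).1.1 ≤ i.k := (scale_bounds i.D.toDomains _).2
  have hpow : (((ℓ + 1) ^ (blkOf i.D.toDomains z).1.1 : ℕ) : ℝ) ≤ (((ℓ + 1) ^ i.k : ℕ) : ℝ) := by
    exact_mod_cast Nat.pow_le_pow_right (Nat.succ_pos ℓ) hjk
  have hpos : (0 : ℝ) < (((ℓ + 1) ^ (blkOf i.D.toDomains z).1.1 : ℕ) : ℝ) := by positivity
  have hinv : (((((ℓ + 1) ^ i.k : ℕ) : ℝ)) ^ 2)⁻¹ ≤ (((((ℓ + 1) ^ (blkOf i.D.toDomains z).1.1 : ℕ) : ℝ)) ^ 2)⁻¹ := by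
    apply inv_anti₀ (by positivity)
    exact pow_le_pow_left₀ hpos.le hpow 2
  rw [mul_assoc]
  exact mul_le_mul_of_nonneg_left (mul_le_mul_of_nonneg_right hinv hz0) (by norm_num)

/-- ★ THE `U(N)` SPECIALISATION (the unitary group is averaging-closed, [B7] Prop. 2 for C⋆-algebras).
[cite: Balaban1985BackgroundPropagators, Thm 3.1 p.397, Thm 3.11 p.416; Balaban1985Averaging, Prop. 2 (52)–(54) p.26, (22)–(23) p.21] -/
theorem trIP_deltaPrimeAY_parKnitY_ge_unitary [Nonempty (Fin N)] {U : CfgY (Matrix (Fin N) (Fin N) ℂ) i} {c α₀ : ℝ}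
    (hC0 : 0 ≤ c * (kGeo i).M * α₀) (hC1 : c * (kGeo i).M * α₀ * ((d : ℝ) + 1) ≤ 1 / 16)
    (hreg : (bg9K (Matrix (Fin N) (Fin N) ℂ) (B7Prop2Explicit.unitaryUnits (Matrix (Fin N) (Fin N) ℂ)) i).Reg335 c α₀ U)
    {α₀' : ℝ} (hα : 0 < α₀') (hα3 : C0 (d + 1) * α₀' ≤ 1 / 3) (hα2 : 2 * α₀' ≤ c2' (d + 1) (ℓ + 1)) (hαd : ((d : ℝ) + 1) ^ 2 * α₀' ≤ 1 / 100)
    (h52 : pdev (liftCfg U) < α₀' * ((((ℓ + 1 : ℕ) : ℝ) ^ i.k)⁻¹) ^ 2) (Φ : SiteY i → Matrix (Fin N) (Fin N) ℂ) :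
    (1 / 32 : ℝ) * (((((ℓ + 1) ^ i.k : ℕ) : ℝ)) ^ 2)⁻¹ * trIP (fun _ => (1 : ℝ)) Φ Φ
      ≤ trIP (fun _ => (1 : ℝ)) Φ (deltaPrimeAY i (parKnitY i) U Φ) := by
  letI : CStarAlgebra (Matrix (Fin N) (Fin N) ℂ) := {}
  exact trIP_deltaPrimeAY_parKnitY_ge i le_rfl (B7Prop2Explicit.avgClosed_unitaryUnits (d + 1) (ℓ + 1)) hC0 hC1 hreg hα hα3 hα2 hαd h52 Φ

end Main

end Literature.MathematicalPhysics.QuantumFieldTheory.Balaban1983to89.B9B8KnitLetterCoercive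

end
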